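import Mathlib
import Literature.Computability.AlgebraicComplexity.PermanentBooleanSum
import Summits.ValiantsHypothesis.ValiantsHypothesis.Theorems.BarrierLeverPartitionMinorsHitByVPHiddenStatesSecondShellNestedRows
import Summits.ValiantsHypothesis.ValiantsHypothesis.Theorems.BarrierLeverPartitionMinorsHitByVPHiddenStatesSecondShellPrescribed
import Summits.ValiantsHypothesis.ValiantsHypothesis.Theorems.BarrierLeverPartitionMinorsHitByVPHiddenStatesSecondShellCrossTemplate
import Summits.ValiantsHypothesis.ValiantsHypothesis.Theorems.BarrierLeverPartitionMinorsHitByVPHiddenStatesSecondShellChainFour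
import Summits.ValiantsHypothesis.ValiantsHypothesis.Theorems.BarrierLeverPartitionMinorsHitByVPHiddenStatesSecondShellPathReads
import Summits.ValiantsHypothesis.ValiantsHypothesis.Theorems.BarrierLeverPartitionMinorsHitByVPHiddenStatesSecondShellNested24Z

/-!
# Route BarrierLever — item `PartitionMinorsHitByVP` (stmt-ValiantsHypothesis-19717), line `hidden-states`:
# ★★ THE (2,4) NESTED CELL WITH BOTH EXTRA NODES OUTSIDE — `Y₁ = {p,q} ⊂ Y₂ = {p,q,v,w}`, `v, w ∉ A₁ ∪ C₁` (every `t, h`)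

Helper file (`--supports stmt-ValiantsHypothesis-19717`; cell valiant-natproofs, 𝒟-side door (c), registered line
`Cruxes/PartitionMinorsHitByVP/Lines/hidden_states.lean` v8; prover seat val-np-p6 gen 18).  Closes NO item; definition-free.

`C₁∖A₁ = {p, q}` (attachment `x₀` at `p`), `C₂∖A₂ = {p, q, v, w}` with `v, w ∉ A₁ ∪ C₁`, and some attachment of path 2
outside `A₁` (`A₂∖C₂ ⊄ A₁`).  Orient path 1 = (p < q) and path 2 = (p < q < v < w) with `f₀, f₁` at `p` and the level-1
attachment `f ∉ A₁` at `q`.  The cross minor `D_{B − A₁ + C₂}` has the start row `C₂ = Z₂ ∪ {p, q, v, w}` (`Z₂ = A₂ ∩ C₂`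
inert) whose FOUR movers form the chain `w → v → q → p` (`p` reads `x₀, f₀, f₁`; `q` reads `p`, `f`; `v` reads `q`; `w` reads
`v`), all outside the missing row `A₁`.  By the FOUR-MOVER CHAIN LEMMA (`…SecondShellChainFour.det_eq_zero_of_chain₄`) the only
critical rows are the pure triples `Z₂ ∪ {f, d', d''}`, which contain `f ∉ A₁`.  ★★ `exists_table_secondShell_nested24Free`.
EXACT t = 4 CENSUS (kit j322364/j323376): shape ((2,4),2,0,2,0), 22 680 families (all of them satisfy `A₂∖C₂ ⊄ A₁`).

HONEST LABEL: conjecture-column cell (second shell, every `t, h`); 19717 stays OPEN; nothing on crux 14610 or VP ≠ VNP.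
-/

set_option linter.dupNamespace false

namespace Summit.ValiantsHypothesis.ValiantsHypothesis.Theorems.BarrierLever.HiddenStates

open Finset

noncomputable section

namespace SecondShell

open PathTable

/-! ## ★★ The (2,4) nested cell with both extra nodes outside `A₁ ∪ C₁` -/

set_option maxHeartbeats 400000 in
/-- ★★ **SECOND SHELL, (2,4) NESTED CLASSES WITH `v, w ∉ A₁ ∪ C₁`, EVERY `t, h`.**  `C₁∖A₁ = {p,q}`, `C₂∖A₂ = {p,q,v,w}`,
`v, w ∉ A₁ ∪ C₁`, `A₂∖C₂ ⊄ A₁`: the class is served by a two-parameter path table. -/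
theorem exists_table_secondShell_nested24Free (h t : ℕ) (A₁ A₂ C₁ C₂ : Finset (Fin h))
    (hA₁ : A₁.card = t) (hA₂ : A₂.card = t) (hC₁ : C₁.card = t + 1) (hC₂ : C₂.card = t + 1)
    (h₁ : ¬ A₁ ⊆ C₁) (h₂ : ¬ A₂ ⊆ C₂) (hA : A₁ ≠ A₂) (hC : C₁ ≠ C₂)
    {yp yq yv yw : Fin h}
    (hY₁ : C₁ \ A₁ = {yp, yq}) (hpq : yp ≠ yq) (hY₂ : C₂ \ A₂ = {yp, yq, yv, yw}) (hpv : yp ≠ yv) (hpw : yp ≠ yw)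
    (hqv : yq ≠ yv) (hqw : yq ≠ yw) (hvw : yv ≠ yw) (hvA : yv ∉ A₁) (hvC : yv ∉ C₁) (hwA : yw ∉ A₁) (hwC : yw ∉ C₁)
    (hX : ¬ A₂ \ C₂ ⊆ A₁)
    {r : ℕ} (u cols : Fin r → Finset (Fin h)) (hu : Function.Injective u)
    (hU : ∀ i, ((u i).card ≤ t ∧ u i ≠ A₁ ∧ u i ≠ A₂) ∨ u i = C₁ ∨ u i = C₂)
    (hcols : ∀ J : Finset (Fin h), J.card ≤ t → ∃ kk, cols kk = J) :
    ∃ tx : Option (Fin h) → Fin h → ℂ,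
      (Matrix.of fun i kk : Fin r => ∏ a ∈ u i, (tx none a + ∑ q ∈ cols kk, tx (some q) a)).det ≠ 0 := by
  classical
  obtain ⟨k₁, j₁, j₁', hk₁, hkj₁, a1, a2, a3, a4⟩ := swap_sizes A₁ C₁ hA₁ hC₁ h₁
  obtain ⟨k₂, j₂, j₂', hk₂, hkj₂, b1, b2, b3, b4⟩ := swap_sizes A₂ C₂ hA₂ hC₂ h₂
  have hY₁c : (C₁ \ A₁).card = 2 := by rw [hY₁, Finset.card_pair hpq]
  have hY₂c : (C₂ \ A₂).card = 4 := by
    rw [hY₂, Finset.card_insert_of_notMem (by simp [hpq, hpv, hpw]), Finset.card_insert_of_notMem (by simp [hqv, hqw]),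
      Finset.card_pair hvw]
  obtain rfl : k₁ = 1 := by omega
  obtain rfl : k₂ = 3 := by omega
  -- membership facts
  have hyp₁ : yp ∈ C₁ \ A₁ := by rw [hY₁]; simp
  have hyq₁ : yq ∈ C₁ \ A₁ := by rw [hY₁]; simp
  have hyp₂ : yp ∈ C₂ \ A₂ := by rw [hY₂]; simp
  have hyq₂ : yq ∈ C₂ \ A₂ := by rw [hY₂]; simp
  have hyv₂ : yv ∈ C₂ \ A₂ := by rw [hY₂]; simp
  have hyw₂ : yw ∈ C₂ \ A₂ := by rw [hY₂]; simp
  obtain ⟨⟨hypC₁, hypA₁⟩, ⟨hyqC₁, hyqA₁⟩⟩ := And.intro (Finset.mem_sdiff.1 hyp₁) (Finset.mem_sdiff.1 hyq₁)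
  obtain ⟨⟨hypC₂, hypA₂⟩, ⟨hyqC₂, hyqA₂⟩, ⟨hyvC₂, hyvA₂⟩, ⟨hywC₂, hywA₂⟩⟩ :=
    And.intro (Finset.mem_sdiff.1 hyp₂) (And.intro (Finset.mem_sdiff.1 hyq₂)
      (And.intro (Finset.mem_sdiff.1 hyv₂) (Finset.mem_sdiff.1 hyw₂)))
  -- attachments: `x₀`; `f ∉ A₁` at level 1, `f₀, f₁` at level 0
  obtain ⟨x₀, hX₁⟩ := Finset.card_eq_one.1 a2
  have hx₀ : x₀ ∈ A₁ \ C₁ := by rw [hX₁]; simp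
  obtain ⟨f, hfX, hfA⟩ := Finset.not_subset.1 hX
  have hc : ((A₂ \ C₂).erase f).card = 2 := by rw [Finset.card_erase_of_mem hfX, b2]
  obtain ⟨f₀, f₁, hf₀₁, hXe⟩ := Finset.card_eq_two.1 hc
  have hf₀e : f₀ ∈ (A₂ \ C₂).erase f := by rw [hXe]; simp
  have hf₁e : f₁ ∈ (A₂ \ C₂).erase f := by rw [hXe]; simp
  obtain ⟨hf₀, hf₀X⟩ := Finset.mem_erase.1 hf₀e
  obtain ⟨hf₁, hf₁X⟩ := Finset.mem_erase.1 hf₁e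
  -- transports: path 1 = (p < q), x₀ at p; path 2 = (p < q < v < w), f₀, f₁ at p, f at q
  have hmemY₁ : ∀ i, ![yp, yq] i ∈ C₁ \ A₁ := by
    intro i; fin_cases i
    · exact hyp₁
    · exact hyq₁
  have hmemX₁ : ∀ i, ![x₀] i ∈ A₁ \ C₁ := by intro i; fin_cases i; exact hx₀
  have hmemY₂ : ∀ i, ![yp, yq, yv, yw] i ∈ C₂ \ A₂ := by
    intro i; fin_cases i
    · exact hyp₂
    · exact hyq₂
    · exact hyv₂
    · exact hyw₂
  have hmemX₂ : ∀ i, ![f₀, f₁, f] i ∈ A₂ \ C₂ := by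
    intro i; fin_cases i
    · exact hf₀X
    · exact hf₁X
    · exact hfX
  have hinj1 : Function.Injective ![x₀] := fun i i' _ => by fin_cases i; fin_cases i'; rfl
  obtain ⟨e₁, m1, m2, m3, m4, hpy₁, hpx₁⟩ := exists_equiv_prescribed A₁ C₁ a1 a2 a3 a4 _ (injective_vec2 hpq) hmemY₁ _
    hinj1 hmemX₁
  obtain ⟨e₂, n1, n2, n3, n4, hpy₂, hpx₂⟩ := exists_equiv_prescribed A₂ C₂ b1 b2 b3 b4 _
    (Literature.Computability.AlgebraicComplexity.injective_vec4 hpq hpv hpw hqv hqw hvw) hmemY₂ _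
    (injective_vec3 hf₀₁ hf₀ hf₁) hmemX₂
  have he₁p : e₁ (Sum.inl (Sum.inl 0)) = yp := by rw [hpy₁]; rfl
  have he₁q : e₁ (Sum.inl (Sum.inl 1)) = yq := by rw [hpy₁]; rfl
  have he₁x : e₁ (Sum.inl (Sum.inr 0)) = x₀ := by rw [hpx₁]; rfl
  have he₂p : e₂ (Sum.inl (Sum.inl 0)) = yp := by rw [hpy₂]; rfl
  have he₂q : e₂ (Sum.inl (Sum.inl 1)) = yq := by rw [hpy₂]; rfl
  have he₂v : e₂ (Sum.inl (Sum.inl 2)) = yv := by rw [hpy₂]; rfl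
  have he₂w : e₂ (Sum.inl (Sum.inl 3)) = yw := by rw [hpy₂]; rfl
  have he₂f₀ : e₂ (Sum.inl (Sum.inr 0)) = f₀ := by rw [hpx₂]; rfl
  have he₂f₁ : e₂ (Sum.inl (Sum.inr 1)) = f₁ := by rw [hpx₂]; rfl
  have he₂f : e₂ (Sum.inl (Sum.inr 2)) = f := by rw [hpx₂]; rfl
  refine exists_table_secondShell_of_cross h t A₁ A₂ C₁ C₂ hA₁ hA₂ hC₁ hC₂ hA hC hk₁ hkj₁ hk₂ hkj₂ e₁ m1 m2 m3 m4
    e₂ n1 n2 n3 n4 u cols hu hU hcols (Or.inl ?_)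
  intro rows i₀ hrow₀ key hcolcard ε
  -- table facts
  have R₁ := fun d => path₁_reads e₁ he₁p he₁q he₁x d
  have R₂ := fun d => path₃_reads e₂ he₂p he₂q he₂v he₂w he₂f₀ he₂f₁ he₂f d
  have v₁pq := path₁_zero e₁ he₁p he₁q
  obtain ⟨v₂pq, v₂pv, v₂pw, v₂qv, v₂qw, v₂vp, v₂vw, v₂wp, v₂wq⟩ := path₃_zeros e₂ he₂p he₂q he₂v he₂w
  have v₁v : ∀ d, swapTable' e₁ yv d = if d = yv then 1 else 0 :=
    row_unit A₁ C₁ e₁ m1 (fun h' => hvC (Finset.mem_sdiff.1 h').1)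
  have v₁w : ∀ d, swapTable' e₁ yw d = if d = yw then 1 else 0 :=
    row_unit A₁ C₁ e₁ m1 (fun h' => hwC (Finset.mem_sdiff.1 h').1)
  have v₁pv : swapTable' e₁ yp yv = 0 := by
    by_contra h'; exact hvA ((((R₁ yv).1 h' hpv.symm) ▸ Finset.mem_sdiff.1 hx₀).1)
  have v₁pw : swapTable' e₁ yp yw = 0 := by
    by_contra h'; exact hwA ((((R₁ yw).1 h' hpw.symm) ▸ Finset.mem_sdiff.1 hx₀).1)
  have v₁qv : swapTable' e₁ yq yv = 0 := by by_contra h'; exact hpv.symm ((R₁ yv).2 h' hqv.symm)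
  have v₁qw : swapTable' e₁ yq yw = 0 := by by_contra h'; exact hpw.symm ((R₁ yw).2 h' hqw.symm)
  have hunit : ∀ d, d ∈ A₁ \ C₁ ∨ d ∈ A₂ \ C₂ → ∀ q, swapTable' e₁ d q = (if q = d then 1 else 0) ∧
      swapTable' e₂ d q = (if q = d then 1 else 0) := by
    intro d hd q
    have hd₁ : d ∉ C₁ \ A₁ := by
      rcases hd with hd | hd
      · exact fun h' => (Finset.mem_sdiff.1 h').2 (Finset.mem_sdiff.1 hd).1
      · intro h'
        rw [hY₁] at h'
        simp only [Finset.mem_insert, Finset.mem_singleton] at h'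
        rcases h' with rfl | rfl
        · exact (Finset.mem_sdiff.1 hd).2 hypC₂
        · exact (Finset.mem_sdiff.1 hd).2 hyqC₂
    have hd₂ : d ∉ C₂ \ A₂ := by
      rcases hd with hd | hd
      · intro h'
        have hdA₁ := (Finset.mem_sdiff.1 hd).1
        rw [hY₂] at h'
        simp only [Finset.mem_insert, Finset.mem_singleton] at h'
        rcases h' with rfl | rfl | rfl | rfl
        · exact hypA₁ hdA₁
        · exact hyqA₁ hdA₁
        · exact hvA hdA₁
        · exact hwA hdA₁
      · exact fun h' => (Finset.mem_sdiff.1 h').2 (Finset.mem_sdiff.1 hd).1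
    exact ⟨row_unit A₁ C₁ e₁ m1 hd₁ q, row_unit A₂ C₂ e₂ n1 hd₂ q⟩
  -- the combined table and what the movers read in it
  set w : Fin h → Fin h → ℂ := tab2 (fun a q => swapTable' e₁ a q - if q = a then 1 else 0)
      (fun a q => swapTable' e₂ a q - if q = a then 1 else 0) ε with hw
  have hwdef : ∀ y q, w y q = (if q = y then 1 else 0) + ε 0 * (swapTable' e₁ y q - if q = y then 1 else 0)
      + ε 1 * (swapTable' e₂ y q - if q = y then 1 else 0) := fun y q => rfl
  have hoff : ∀ y d, d ≠ y → w y d ≠ 0 → swapTable' e₁ y d ≠ 0 ∨ swapTable' e₂ y d ≠ 0 := by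
    intro y d hdy hw0
    by_contra hcon
    push Not at hcon
    apply hw0
    rw [hwdef, hcon.1, hcon.2, if_neg hdy]; ring
  have hreadp : ∀ d, d ≠ yp → w yp d ≠ 0 → d = x₀ ∨ d = f₀ ∨ d = f₁ := by
    intro d hd hw0
    rcases hoff yp d hd hw0 with h' | h'
    · exact Or.inl ((R₁ d).1 h' hd)
    · exact Or.inr ((R₂ d).1 h' hd)
  have hreadq : ∀ d, d ≠ yq → w yq d ≠ 0 → d = yp ∨ d = f := by
    intro d hd hw0
    rcases hoff yq d hd hw0 with h' | h'
    · exact Or.inl ((R₁ d).2 h' hd)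
    · exact (R₂ d).2.1 h' hd
  have hreadv : ∀ d, d ≠ yv → w yv d ≠ 0 → d = yq := by
    intro d hd hw0
    rcases hoff yv d hd hw0 with h' | h'
    · exfalso; apply h'; rw [v₁v d, if_neg hd]
    · exact (R₂ d).2.2.1 h' hd
  have hreadw : ∀ d, d ≠ yw → w yw d ≠ 0 → d = yv := by
    intro d hd hw0
    rcases hoff yw d hd hw0 with h' | h'
    · exfalso; apply h'; rw [v₁w d, if_neg hd]
    · exact (R₂ d).2.2.2 h' hd
  -- the inert part `Z = A₂ ∩ C₂` of the start row `C₂`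
  obtain ⟨Z, hZdef⟩ : ∃ Z : Finset (Fin h), Z = A₂ ∩ C₂ := ⟨_, rfl⟩
  have hZc : Z.card + 3 = t := by rw [hZdef, b3]; omega
  have hyZ : ∀ y, y ∉ A₂ → y ∉ Z := fun y hy h' => hy (Finset.mem_inter.1 (hZdef ▸ h')).1
  have hpZ := hyZ yp hypA₂
  have hqZ := hyZ yq hyqA₂
  have hvZ := hyZ yv hyvA₂
  have hwZ := hyZ yw hywA₂
  have hM4 : ∀ d, d ∉ ({yp, yq, yv, yw} : Finset (Fin h)) ↔ d ≠ yp ∧ d ≠ yq ∧ d ≠ yv ∧ d ≠ yw := by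
    intro d; simp only [Finset.mem_insert, Finset.mem_singleton, not_or]
  have hexit : ∀ d, d ≠ yp → d ≠ yq → d ≠ yv → d ≠ yw → (w yp d ≠ 0 ∨ w yq d ≠ 0 ∨ w yv d ≠ 0 ∨ w yw d ≠ 0) →
      d ∈ A₁ \ C₁ ∨ d ∈ A₂ \ C₂ := by
    intro d hdp hdq hdv hdw hread
    rcases hread with h' | h' | h' | h'
    · rcases hreadp d hdp h' with rfl | rfl | rfl
      · exact Or.inl hx₀
      · exact Or.inr hf₀X
      · exact Or.inr hf₁X
    · rcases hreadq d hdq h' with h | rfl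
      · exact absurd h hdp
      · exact Or.inr hfX
    · exact absurd (hreadv d hdv h') hdq
    · exact absurd (hreadw d hdw h') hdv
  -- rows through a mover, and small rows, are present (every mover lies outside `A₁`)
  have hmov : ∀ S : Finset (Fin h), S.card ≤ t → (∃ y ∈ S, y ∉ A₁) → ∃ i, i ≠ i₀ ∧ rows i = S :=
    fun S hS ⟨y, hyS, hyA⟩ => key S hS fun hSA => hyA (hSA ▸ hyS)
  have hcardT : ∀ T : Finset (Fin h), Disjoint T Z → T.card ≤ 3 → (T ∪ Z).card ≤ t := fun T hT hT3 => by
    rw [Finset.card_union_of_disjoint hT]; omega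
  have hdisj3 : ∀ p q s : Fin h, p ∉ Z → q ∉ Z → s ∉ Z → Disjoint ({p, q, s} : Finset (Fin h)) Z := by
    intro p q s hp hq hs
    rw [Finset.disjoint_insert_left, Finset.disjoint_insert_left, Finset.disjoint_singleton_left]; exact ⟨hp, hq, hs⟩
  have hrow3 : ∀ p q s : Fin h, p ∉ A₁ → p ∉ Z → q ∉ Z → s ∉ Z → ∃ i, i ≠ i₀ ∧ rows i = {p, q, s} ∪ Z := by
    intro p q s hpA hp hq hs
    exact hmov _ (hcardT _ (hdisj3 p q s hp hq hs) Finset.card_le_three) ⟨p, Finset.mem_union_left _ (by simp), hpA⟩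
  refine det_eq_zero_of_chain₄ w rows cols i₀ Z hpq hpv hpw hqv hqw hvw hpZ hqZ hvZ hwZ
    ?_ ?_ ?_ ?_ ?_ ?_ ?_ ?_ ?_ ?_ ?_ ?_ ?_ ?_ ?_ ?_ ?_ ?_ ?_ ?_ ?_ ?_ ?_ ?_ ?_ ?_ ?_ ?_
  · -- unit rows on `Z = A₂ ∩ C₂`
    intro z hz q
    obtain ⟨hzA, hzC⟩ := Finset.mem_inter.1 (hZdef ▸ hz)
    have hz₂ : z ∉ C₂ \ A₂ := fun h' => (Finset.mem_sdiff.1 h').2 hzA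
    have hz₁ : z ∉ C₁ \ A₁ := by
      intro h'
      rw [hY₁] at h'
      simp only [Finset.mem_insert, Finset.mem_singleton] at h'
      rcases h' with rfl | rfl
      · exact hypA₂ hzA
      · exact hyqA₂ hzA
    rw [hwdef, row_unit A₁ C₁ e₁ m1 hz₁ q, row_unit A₂ C₂ e₂ n1 hz₂ q]; ring
  · rw [hwdef, swapTable'_self, swapTable'_self, if_pos rfl]; ring
  · rw [hwdef, v₁pq, v₂pq, if_neg hpq.symm]; ring
  · rw [hwdef, v₁pv, v₂pv, if_neg hpv.symm]; ring
  · rw [hwdef, v₁pw, v₂pw, if_neg hpw.symm]; ring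
  · rw [hwdef, swapTable'_self, swapTable'_self, if_pos rfl]; ring
  · rw [hwdef, v₁qv, v₂qv, if_neg hqv.symm]; ring
  · rw [hwdef, v₁qw, v₂qw, if_neg hqw.symm]; ring
  · rw [hwdef, swapTable'_self, swapTable'_self, if_pos rfl]; ring
  · rw [hwdef, v₁v yp, v₂vp, if_neg hpv]; ring
  · rw [hwdef, v₁v yw, v₂vw, if_neg hvw.symm]; ring
  · rw [hwdef, swapTable'_self, swapTable'_self, if_pos rfl]; ring
  · rw [hwdef, v₁w yp, v₂wp, if_neg hpw]; ring
  · rw [hwdef, v₁w yq, v₂wq, if_neg hqw]; ring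
  · -- read exits are attachments, hence unit rows
    intro d _ hdM hread q
    obtain ⟨hdp, hdq, hdv, hdw⟩ := (hM4 d).1 hdM
    have hd := hexit d hdp hdq hdv hdw hread
    rw [hwdef, (hunit d hd q).1, (hunit d hd q).2]; ring
  · -- the start row `C₂ = Z ∪ {p, q, v, w}`
    rw [hrow₀, hZdef]
    ext x
    simp only [Finset.mem_insert, Finset.mem_inter]
    constructor
    · intro hx
      by_cases hxA : x ∈ A₂
      · exact Or.inr (Or.inr (Or.inr (Or.inr ⟨hxA, hx⟩)))
      · have hxY : x ∈ C₂ \ A₂ := Finset.mem_sdiff.2 ⟨hx, hxA⟩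
        rw [hY₂] at hxY
        simp only [Finset.mem_insert, Finset.mem_singleton] at hxY
        rcases hxY with h' | h' | h' | h'
        · exact Or.inl h'
        · exact Or.inr (Or.inl h')
        · exact Or.inr (Or.inr (Or.inl h'))
        · exact Or.inr (Or.inr (Or.inr (Or.inl h')))
    · rintro (rfl | rfl | rfl | rfl | ⟨-, hx⟩)
      · exact hypC₂
      · exact hyqC₂
      · exact hyvC₂
      · exact hywC₂
      · exact hx
  · intro kk; rw [hZc]; exact hcolcard kk
  · -- small rows and mover rows
    intro T hTZ hT _
    rcases hT with hT2 | ⟨hTM, hT3⟩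
    · refine key _ (hcardT T hTZ (by omega)) fun hEq => ?_
      have h1 := Finset.card_union_of_disjoint hTZ; rw [hEq, hA₁] at h1; omega
    · by_cases hT0 : T = ∅
      · refine key _ (hcardT T hTZ hT3) fun hEq => ?_
        have h1 := Finset.card_union_of_disjoint hTZ; rw [hEq, hA₁, hT0, Finset.card_empty] at h1; omega
      · obtain ⟨y, hy⟩ := Finset.nonempty_iff_ne_empty.2 hT0
        refine hmov _ (hcardT T hTZ hT3) ⟨y, Finset.mem_union_left _ hy, ?_⟩
        have hyM := hTM hy
        simp only [Finset.mem_insert, Finset.mem_singleton] at hyM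
        rcases hyM with rfl | rfl | rfl | rfl
        · exact hypA₁
        · exact hyqA₁
        · exact hvA
        · exact hwA
  · intro d hdZ _ _; exact hrow3 yp yq d hypA₁ hpZ hqZ hdZ
  · intro d hdZ _ _ _; exact hrow3 yp yv d hypA₁ hpZ hvZ hdZ
  · intro d hdZ _ _; exact hrow3 yp yw d hypA₁ hpZ hwZ hdZ
  · intro d hdZ _ _ _; exact hrow3 yq yv d hyqA₁ hqZ hvZ hdZ
  · intro d hdZ _ _ _; exact hrow3 yq yw d hyqA₁ hqZ hwZ hdZ
  · intro d hdZ _ _; exact hrow3 yv yw d hvA hvZ hwZ hdZ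
  · intro d d' _ hdZ hd'Z _ _ _ _; exact hrow3 yp d d' hypA₁ hpZ hdZ hd'Z
  · intro d d' _ hdZ hd'Z _ _ _ _; exact hrow3 yq d d' hyqA₁ hqZ hdZ hd'Z
  · intro d d' _ hdZ hd'Z _ _ _ _; exact hrow3 yw d d' hwA hwZ hdZ hd'Z
  · -- ★ the pure triples contain the `q`-exit `d = f ∉ A₁`
    intro d d' d'' _ _ _ hdZ hd'Z hd''Z hdM _ _ hqd _ _
    obtain ⟨hdp, hdq, -, -⟩ := (hM4 d).1 hdM
    have hdf : d = f := by
      rcases hreadq d hdq hqd with h' | h'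
      · exact absurd h' hdp
      · exact h'
    exact hrow3 d d' d'' (hdf ▸ hfA) hdZ hd'Z hd''Z

end SecondShell

end

end Summit.ValiantsHypothesis.ValiantsHypothesis.Theorems.BarrierLever.HiddenStates
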